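import Literature.AnabelianGeometry.EtaleTheta.TemperedFrobenioidCor38SubPreStepsFrobenius
import HarnessLib

/-!
# [EtTh] Cor. 3.8 proof row C38-L02a `PreservesPreSteps` (F-2809): WEAK PARTNERS — a pre-step `φ : P → Q` whose
# target maps back to a Frobenius power `P^{(d)}` of its source is preserved, over bases without "returns"

S. Mochizuki, *The étale theta function and its Frobenioid-theoretic manifestations*, Publ. RIMS **45** (2009)
[EtTh], Cor. 3.8, proof, PDF p. 81 l. 2–3 ("by [Mzk17], Theorem 3.4, (ii) … it follows that `Ψ` preserves
pre-steps") [cite: MochizukiEtTh2009, Cor 3.8 p.81]; S. Mochizuki, *The geometry of Frobenioids I*, Kyushu J. Math.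
**62** (2008) [FrdI], §0 pp. 14–18 (FSM-morphisms, FSMFF-type, "if `α ∘ β` is an isomorphism then `α`, `β` are
isomorphisms" in a totally epimorphic category, p. 16), Def. 1.2 (iii) p. 22 (pre-steps), Thm. 5.2 (i)–(ii) pp. 100–101
(model Frobenioids, the pure Frobenius morphisms `F_d = (d, id, 0, 0)`) [cite: MochizukiFrdI2008, §0 p.16].

abc-iut cell, block C / F (FACT-proving wave), seat abc-iut-f-128 (gen 15).  PROOF-ONLY file (0 definitions), hand #12
for the decision on the bare universal closure of `Cor38Hyp.PreservesPreSteps` (FACT-LIST F-2809; label of record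
unchanged: conditional / instance forms PROVED / bare ∀-closure UNDECIDED as typed).  abc-iut-f-109 / abc-iut-w6-d079
proved: a pre-step `φ : X → Y` with a PARTNER (a pre-step `ψ : Y → X` over the inverse base arrow) is carried to a
pre-step, for every record.  This file weakens "partner" twice: `ψ : Q → P^{(d)}` may be ANY morphism, and may land in
ANY Frobenius power `P^{(d)} = (A, d·α)` of the source (a "weak partner of exponent `d`"; for `d ≥ 2` these exist as
soon as some power of the class of `P` absorbs the zero divisor of `φ`, e.g. `y | x·y` at `P = (A, x + y)` although
`(A, x + 2y) → (A, x + y)` has no arrow) — at the price of a hypothesis on the target base: an FSM arrow `A → A'` of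
`D₂` admitting an arrow `A' → A'' ≅ A` back is invertible (automatic for THIN bases: points, the walking arrow, towers
`(ℕ, ≥)`, every poset; there even "arrow back ⇒ invertible" by total epimorphicity alone).

WHAT IS PROVED (every record `h : Cor38Hyp C₁ C₂`; `Φ₁` cancellative where named).
* **`Cor38Hyp.isPreStep_map_of_hom_to_powObj`** — if `φ : P → Q` is a pre-step of `C₁`, `ψ : Q → P^{(d)}` is any
  morphism, `Base(Ψ F_d^P)` is invertible (automatic for `d = 1`; for prime `d` it is the first alternative of
  `Cor38Hyp.frobenius_dichotomy`, hand #11), and in `D₂` every FSM arrow `g : A → A'` with `Hom(A', A) ≠ ∅` is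
  invertible, then `Ψ φ` is a pre-step.  (`Base(Ψ φ)` is FSM by abc-iut-f-151 / w6-d057 / w6-d079, and
  `Base(Ψ ψ) ≫ Base(Ψ F_d^P)⁻¹ : A' → A` is an arrow back.)
* **`Cor38Hyp.isPreStep_map_of_hom_to_source`** — the exponent-one case (`ψ : Q → P` arbitrary): no Frobenius hypothesis.
* **`Cor38Hyp.isPreStep_map_of_hom_to_powObj_of_thin`**, **`…_of_hom_to_source_of_thin`** — thin `D₂`: the base
  hypothesis is discharged by `[Quiver.IsThin D₂]` (an endomorphism of a thin category is the identity, so an arrow with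
  an arrow back is split mono and epi).
* the `Ψ⁻¹` mirrors `Cor38Hyp.isPreStep_inverse_map_of_hom_to_source(_of_thin)` (cancellative `Φ₂`).
READING (cell rule R5; FACT-LIST label NOT moved).  Over thin / "no-return" bases a separating record with cancellative
divisor monoids must move a pre-step `φ : P → Q` such that `Q` admits NO morphism to ANY Frobenius power `P^{(d)}` whose
`Ψ F_d^P` lies in the first Frobenius alternative — with hand #10 (finitely many failures per ω-chain) and hand #11
(Frobenius-stability of the failure set) this localises any failure at objects `P = (A, α)` on the boundary of the
"`Div(φ)`-negative half-space": no power `α^k` is `Div(φ)`-positive modulo principal divisors (desk census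
HOME/staging/f/f-128/g15/F-2809-CENSUS-10-f128g15.md §2(d)–(e)).  No [FrdI] Thm. 3.4 input; no Frobenioid axiom;
vocabulary clauses untouched.  HONEST FRAMING: bookkeeping about OUR typed Def. 3.6 interface (print's Cor. 3.8 quotes
[FrdI] Thm. 3.4 (ii) for genuine Frobenioids); proved-as-typed ≠ proved-in-print; nothing here bears on [IUTchIII]
Cor. 3.12; no side taken; a FACT row is an assumption label; typed ≠ proved.
-/

namespace Literature.AnabelianGeometry.EtaleTheta

open CategoryTheory Opposite Literature.AlgebraicGeometry.Frobenioids
open ModelFrobenioid (powUnitHom powObj powHom degFr baseMap)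

universe u₀ v₀ u v w

variable {D₀ : Type u₀} [Category.{v₀} D₀] {V : FrdIMonoidStub.{w}}
  {T : RealifiedDivisorMonoids (D₀ := D₀) V} {D : Type u} [Category.{v} D] {VD : FrdICatStub.{u, v, w} D}

section Rows

variable {D₀' : Type u₀} [Category.{v₀} D₀'] {T' : RealifiedDivisorMonoids (D₀ := D₀') V}
  {D' : Type u} [Category.{v} D'] {VD' : FrdICatStub.{u, v, w} D'}
  {C₁ : TemperedFrobenioid T D VD} {C₂ : TemperedFrobenioid T' D' VD'}

/-- In a THIN category every arrow `g : A → A'` admitting an arrow `t : A' → A` back is an isomorphism as soon as the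
category is totally epimorphic: `g ≫ t` is an endomorphism of `A`, hence the identity, so `g` is split mono and epi
([FrdI] §0 p. 16). [cite: MochizukiFrdI2008, §0 p.16] -/
theorem isIso_of_hom_back_of_thin {E : Type*} [Category E] [Quiver.IsThin E] (hE : IsTotallyEpimorphic E)
    {A A' : E} (g : A ⟶ A') (t : A' ⟶ A) : IsIso g := by
  haveI : IsIso (g ≫ t) := by
    rw [show g ≫ t = 𝟙 A from Subsingleton.elim _ _]
    infer_instance
  exact (hE.isIso_of_isIso_comp g t).2

namespace Cor38Hyp

variable (h : Cor38Hyp C₁ C₂)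

/-- **WEAK PARTNERS, every record (cancellative `Φ₁`)**: let `φ : P → Q` be a pre-step of `C₁` and `ψ : Q → P^{(d)}`
ANY morphism into a Frobenius power of its source, such that `Base(Ψ F_d^P)` is invertible; if in `D₂` every FSM arrow
`g : A → A'` with `Hom(A', A)` non-empty is invertible, then `Ψ φ` is a pre-step — `Base(Ψ φ)` is FSM (abc-iut-f-151,
w6-d057, w6-d079) and `Base(Ψ ψ) ≫ Base(Ψ F_d^P)⁻¹` is an arrow back. [cite: MochizukiEtTh2009, Cor 3.8 p.81] -/
theorem isPreStep_map_of_hom_to_powObj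
    (hΦ : ∀ (A : Dᵒᵖ) (x y z : C₁.Φ.carrier A), x * y = x * z → y = z)
    (hD' : ∀ ⦃A A' : D'⦄ (g : A ⟶ A'), IsFSM g → Nonempty (A' ⟶ A) → IsIso g)
    {P Q : C₁.category} (φ : P ⟶ Q) (hφ : C₁.opsData.IsPreStep φ) (d : ℕ+)
    (ψ : Q ⟶ powObj C₁.divisorMonoid C₁.ratFnFunctor C₁.divBNatTrans d P)
    (hF : IsIso (baseMap (h.Ψ.functor.map (powUnitHom C₁.divisorMonoid C₁.ratFnFunctor C₁.divBNatTrans d P)))) :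
    C₂.opsData.IsPreStep (h.Ψ.functor.map φ) := by
  refine (C₂.opsData_isPreStep_iff _).2 ⟨h.isLinear_map_of_isPreStep φ hφ, ?_⟩
  haveI := hF
  exact hD' _ (h.isFSM_baseMap_map_of_isPreStep_of_isLinear hΦ φ hφ (h.isLinear_map_of_isPreStep φ hφ))
    ⟨baseMap (h.Ψ.functor.map ψ) ≫
      inv (baseMap (h.Ψ.functor.map (powUnitHom C₁.divisorMonoid C₁.ratFnFunctor C₁.divBNatTrans d P)))⟩

/-- **Exponent one, every record (cancellative `Φ₁`)**: a pre-step `φ : P → Q` of `C₁` whose target admits ANY morphism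
`ψ : Q → P` back to its source is carried to a pre-step, provided in `D₂` every FSM arrow admitting an arrow back is
invertible (abc-iut-f-109's partner closer asked `ψ` to be a pre-step over the inverse base arrow).
[cite: MochizukiEtTh2009, Cor 3.8 p.81] -/
theorem isPreStep_map_of_hom_to_source
    (hΦ : ∀ (A : Dᵒᵖ) (x y z : C₁.Φ.carrier A), x * y = x * z → y = z)
    (hD' : ∀ ⦃A A' : D'⦄ (g : A ⟶ A'), IsFSM g → Nonempty (A' ⟶ A) → IsIso g)
    {P Q : C₁.category} (φ : P ⟶ Q) (hφ : C₁.opsData.IsPreStep φ) (ψ : Q ⟶ P) :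
    C₂.opsData.IsPreStep (h.Ψ.functor.map φ) := by
  refine (C₂.opsData_isPreStep_iff _).2 ⟨h.isLinear_map_of_isPreStep φ hφ, ?_⟩
  exact hD' _ (h.isFSM_baseMap_map_of_isPreStep_of_isLinear hΦ φ hφ (h.isLinear_map_of_isPreStep φ hφ))
    ⟨baseMap (h.Ψ.functor.map ψ)⟩

/-- The mirror for `Ψ⁻¹` (cancellative `Φ₂`): a pre-step `φ : P → Q` of `C₂` with a morphism `Q → P` back goes to a
pre-step of `C₁`, provided in `D₁` every FSM arrow admitting an arrow back is invertible. [cite: MochizukiEtTh2009, Cor 3.8 p.81] -/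
theorem isPreStep_inverse_map_of_hom_to_source
    (hΦ' : ∀ (A : D'ᵒᵖ) (x y z : C₂.Φ.carrier A), x * y = x * z → y = z)
    (hD : ∀ ⦃A A' : D⦄ (g : A ⟶ A'), IsFSM g → Nonempty (A' ⟶ A) → IsIso g)
    {P Q : C₂.category} (φ : P ⟶ Q) (hφ : C₂.opsData.IsPreStep φ) (ψ : Q ⟶ P) :
    C₁.opsData.IsPreStep (h.Ψ.inverse.map φ) := by
  have hlin := h.isLinear_inverse_map_of_isPreStep φ hφ
  refine (C₁.opsData_isPreStep_iff _).2 ⟨hlin, ?_⟩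
  have hφ' := (C₂.opsData_isPreStep_iff φ).1 hφ
  haveI : IsIso (ModelFrobenioid.baseMap φ) := hφ'.2
  haveI : Mono φ := C₂.mono_of_degFr_eq_one hΦ' φ hφ'.1
  haveI : Mono (h.Ψ.inverse.map φ) := h.mono_inverse_map_of_mono φ
  exact hD _ ⟨h.isFiberwiseSurjective_baseMap_inverse_map_of_isPreStep φ hφ,
    ModelFrobenioid.mono_baseMap_of_mono_of_degFr_eq_one _ hlin⟩ ⟨baseMap (h.Ψ.inverse.map ψ)⟩

/-- **Thin target base**: over a THIN `D₂` (points, the walking arrow, towers, posets) a pre-step `φ : P → Q` of `C₁`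
(cancellative `Φ₁`) whose target admits a morphism `ψ : Q → P^{(d)}` with `Base(Ψ F_d^P)` invertible is carried to a
pre-step. [cite: MochizukiEtTh2009, Cor 3.8 p.81] -/
theorem isPreStep_map_of_hom_to_powObj_of_thin [Quiver.IsThin D']
    (hΦ : ∀ (A : Dᵒᵖ) (x y z : C₁.Φ.carrier A), x * y = x * z → y = z)
    {P Q : C₁.category} (φ : P ⟶ Q) (hφ : C₁.opsData.IsPreStep φ) (d : ℕ+)
    (ψ : Q ⟶ powObj C₁.divisorMonoid C₁.ratFnFunctor C₁.divBNatTrans d P)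
    (hF : IsIso (baseMap (h.Ψ.functor.map (powUnitHom C₁.divisorMonoid C₁.ratFnFunctor C₁.divBNatTrans d P)))) :
    C₂.opsData.IsPreStep (h.Ψ.functor.map φ) :=
  h.isPreStep_map_of_hom_to_powObj hΦ (fun _ _ g _ ⟨t⟩ => isIso_of_hom_back_of_thin C₂.isTotallyEpimorphic g t)
    φ hφ d ψ hF

/-- **Thin target base, exponent one**: over a thin `D₂`, a pre-step of `C₁` (cancellative `Φ₁`) whose target admits
any morphism back to its source is carried to a pre-step. [cite: MochizukiEtTh2009, Cor 3.8 p.81] -/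
theorem isPreStep_map_of_hom_to_source_of_thin [Quiver.IsThin D']
    (hΦ : ∀ (A : Dᵒᵖ) (x y z : C₁.Φ.carrier A), x * y = x * z → y = z)
    {P Q : C₁.category} (φ : P ⟶ Q) (hφ : C₁.opsData.IsPreStep φ) (ψ : Q ⟶ P) :
    C₂.opsData.IsPreStep (h.Ψ.functor.map φ) :=
  h.isPreStep_map_of_hom_to_source hΦ (fun _ _ g _ ⟨t⟩ => isIso_of_hom_back_of_thin C₂.isTotallyEpimorphic g t)
    φ hφ ψ

/-- The mirror for `Ψ⁻¹` over a thin `D₁` (cancellative `Φ₂`). [cite: MochizukiEtTh2009, Cor 3.8 p.81] -/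
theorem isPreStep_inverse_map_of_hom_to_source_of_thin [Quiver.IsThin D]
    (hΦ' : ∀ (A : D'ᵒᵖ) (x y z : C₂.Φ.carrier A), x * y = x * z → y = z)
    {P Q : C₂.category} (φ : P ⟶ Q) (hφ : C₂.opsData.IsPreStep φ) (ψ : Q ⟶ P) :
    C₁.opsData.IsPreStep (h.Ψ.inverse.map φ) :=
  h.isPreStep_inverse_map_of_hom_to_source hΦ' (fun _ _ g _ ⟨t⟩ => isIso_of_hom_back_of_thin C₁.isTotallyEpimorphic g t)
    φ hφ ψ

/-- **Prime exponent with the Frobenius hypothesis read off hand #11**: over a thin `D₂`, if `deg_Fr(Ψ F_p^P) ≥ 2` for a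
prime `p` (first alternative of `Cor38Hyp.frobenius_dichotomy`) and the target of the pre-step `φ : P → Q` admits a
morphism `Q → P^{(p)}`, then `Ψ φ` is a pre-step. [cite: MochizukiEtTh2009, Cor 3.8 p.81] -/
theorem isPreStep_map_of_hom_to_powObj_prime_of_thin [Quiver.IsThin D']
    (hΦ : ∀ (A : Dᵒᵖ) (x y z : C₁.Φ.carrier A), x * y = x * z → y = z)
    {P Q : C₁.category} (φ : P ⟶ Q) (hφ : C₁.opsData.IsPreStep φ) {p : ℕ+} (hp : (p : ℕ).Prime)
    (hdeg : 2 ≤ (degFr (h.Ψ.functor.map (powUnitHom C₁.divisorMonoid C₁.ratFnFunctor C₁.divBNatTrans p P)) : ℕ))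
    (ψ : Q ⟶ powObj C₁.divisorMonoid C₁.ratFnFunctor C₁.divBNatTrans p P) :
    C₂.opsData.IsPreStep (h.Ψ.functor.map φ) := by
  refine h.isPreStep_map_of_hom_to_powObj_of_thin hΦ φ hφ p ψ ?_
  rcases h.frobenius_dichotomy P hp with ⟨-, hi, -⟩ | ⟨h1, -⟩
  · exact hi
  · exfalso
    rw [h1] at hdeg
    exact absurd hdeg (by decide)

end Cor38Hyp

end Rows

end Literature.AnabelianGeometry.EtaleTheta
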